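import Mathlib
import HarnessLib
import HarnessLib.Audit
import Summits.QuantumAdvantage.Statement
import Literature.Computability.Complexity.BoolEncodings
import Literature.Computability.Complexity.CircuitClasses
import Literature.Computability.Complexity.CircuitClassesUniformProofs
import Literature.Computability.Complexity.ConstantDepth
import Literature.Computability.Cryptography.ClassBQP
import Literature.Computability.MetaComplexity.HeuristicClasses
import Literature.NumberTheory.QuadraticFields.ReducedForms
import Literature.Probability.RandomGraphs.LowDegree
import Literature.NumberTheory.QuadraticFields.ThreeTorsion
import HarnessLib.Audit.Status.Attr

/-!
Route: ArithStatLadder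

DORMANT since 2026-08-22T02:06:15Z (reconciler: no traction for 5 d (last activity item-evidence-added at 2026-08-17T01:20:37Z); parked, not closed — `ledger route dormant route-QuantumAdvantage-ArithStatLadder --off` to reactivate) — unstaffed, not closed; items shared with open routes are served there. `ledger route dormant <id> --off` reactivates.

# Route QuantumAdvantage/ArithStatLadder — arithmetic statistics as the average-case theory of
abelian quantum advantage, with the Scholz–Hecke mirror as lever (idea card
arithmetic-statistics-ladder)

## Thesis (rev 4): it suffices to show IQ3 ∈ BQP and IQ3 ∉ BPP; the lever that makes both halves
tractable is the mirror
Words: IQ3 = { bin(d) : −d a fundamental discriminant, 3 ∣ h(−d) }. Installed deciding theorem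
(shape W = the witness form of the summit at L = IQ3): `closes (h₁ : IqThreeMemBQP) (h₂ :
IqThreeNotBPP) : QuantumAdvantage := ⟨_, h₁, h₂⟩`; the binder IqThreeNotBPP is DERIVED from either
sufficient top by a landed one-line item (X = IqThreeNotPPoly via Adleman: NotBPPOfNotPPoly; the
average-case face AvgFaceBeyondPrior via `avgFace_imp_not_mem_BPP`: NotBPPOfAvgFace).
Lean: `Computability.encodingNatBool.toLanguage {d : ℕ | IsFund (−d) ∧ 3 ∣
Literature.NumberTheory.QuadraticFields.BinaryQuadraticForm.classNumber (−d)} ∉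
Literature.Computability.Complexity.BPP` (IsFund literal as in
QuadraticFields/FundamentalDiscriminant.lean; h = form class number = |Cl(O_K)| by the PROVED
`card_reducedForms_eq_classNumber`).

## The lever: 3 ∣ h(−d) is ONE 3-adic digit of the fundamental unit of the real mirror field, off a
Davenport–Heilbronn-rare set
Scholz's reflection (1932) for the pair (ℚ(√3d), ℚ(√−d)) read WITH ITS UNIT DEFECT (Kummer theory
over ℚ(√−d, ζ₃); Hecke Satz 119 at 3) is the exact identity, for −d fundamental, d ≠ 3:
   3 ∣ h(−d)   ⟺   UnitCubeAtThree d   ∨   3 ∣ h(ℚ(√3d)),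
where `QuadraticFields.UnitCubeAtThree d`: the fundamental unit ε = (a + b√d₀)/2 of ℚ(√3d) (d₀ =
squarefree kernel of 3d) is a cube at 3, in the certified elementary spelling (a + b√d₀)⁸ = X +
Y√d₀, X ≡ 4 (mod 9), 9 ∣ Y if 3 ∣ d, 3 ∣ Y if 3 ∤ d (named fact `ScholzHecke_unitCubeCriterion`; 0
violations on all 159 375 fundamental −d < 2^19, kit j012491). The second disjunct holds on a
U-fraction ≤ 1/6 + o(1) of n-bit fundamental −d (Davenport–Heilbronn-real with a 3-adic condition =
Bhargava–Varma Cor 4(b); Cohen–Lenstra value 0.1599). Consequences, all typed in this file: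
(Q) GRH EXITS THE QUANTUM HALF. L_ε = { bin d : −d fundamental, d ≠ 3, UnitCubeAtThree d } ∈ BQP
with NO Riemann hypothesis and every input PROVED in the tree — Hallgren's regulator algorithm is
formalised (`Hallgren2007_regulator_qsolvable_delim_holds`), Jacobson–Williams unit residues from
the regulator (`JacobsonWilliams2008_unitResidue_mem_FP_holds`; data lemma landed:
`Mirror.stub_mirrorUnitData`), Shor for fundamentality (`factoring_mem_FBQP_holds`), and the
transducer L_ε ∈ BQP^{FB ⊕ CU} landed (`Mirror.stub_unitCubeMemBQP`): support UnitCubeMemBQP. Class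
groups — hence Bach's bound and GRH — are never touched.
(C) THE CLASSICAL FACE TRANSPORTS EXACTLY. L_ε agrees with IQ3 off {3 ∣ h(ℚ(√3d))}, so a BPP machine
for L_ε, amplified and patched below n₀, is confidently right about IQ3 on ≥ 2/3 of every block:
supports UnitCubeCriterion (textbook), MirrorRankRare (≤ 1/6 + ε; `Mirror.stub_mirrorRankRare`,
proved modulo one Davenport–Heilbronn cite input), MirrorHeurTransfer (PROVED:
`Mirror.stub_heurTransfer`) and the glue `MirrorAssembly : UnitCubeCriterion → MirrorRankRare →
UnitCubeMemBQP → MirrorHeurTransfer → AvgFaceBeyondPrior → QuantumAdvantage` (kernel-checked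
sorry-free in the planner's Sketch.lean, evidence attached). This is the route's SECOND, GRH-FREE
deciding shape (M): witness L_ε, quantum half theorem-grade in the tree, classical half = the
average-case face alone; installed as `closes` by one `route edit --closes-file` once UnitCubeMemBQP
and MirrorAssembly are closed (binders of `closes` are cruxes or proved lemmas), leaving
AvgFaceBeyondPrior the only hypothesis-type binder and UnitCubeCriterion / MirrorRankRare as
printed-theorem debts.
(R) A SECOND REFUTATION SURFACE: any classical statistic for ε_{ℚ(√3d)} mod 9 right on a positive
fraction refutes AvgFaceBeyondPrior (`not_avgFace_of_unitCubeLang_mem_BPP`).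

## The ladder (earned analytic content: special cases, not binders)
T₃(−d) = #Cl(ℚ(√−d))[3] is a BQP output with a PROVED first moment, power savings, congruence
conditions and short intervals (Davenport–Heilbronn; BST Thm 2/20, Cor 7; Taniguchi–Thorne; BTT
2023; tree facts `bst_threeTorsion_mean`, `btt_threeTorsion_sum`,
`tt_threeTorsion_sum_progression`). "T₃ − 2 is uncorrelated, along n-bit fundamental −d, with all F
in a class C of digit functions" is an unconditional average-case lower bound for a BQP quantity
against C; every rung is a consequence of the correlation apex PPolyRung ⇒ X (kernel-checked,
Cruxes/IqThreeNotPPoly/SketchIdeator3.lean), i.e. a SPECIAL CASE of the thesis, filed as support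
because a rung is implied by the apex and implies nothing upward. R0 EndJuntaRung (k low + k high
digits; IN PRINT: BST Thm 20 + §8.5 / Taniguchi–Thorne AP theorem). R1 DigitRung (ONE digit at ANY
position; in print for j ≤ (5/43)n and j ≥ (2/3)n, unproved in the middle band =
"Davenport–Heilbronn on minor arcs": cancellation in Σ_{d∈𝒟_n}(t(−d) − 2)·e(rd/2^k), r odd, k ≤ 3n/4
+ 1) — the tier list's deciding crux, dropped as a crux at rev 3 (unused-crux rule) and RE-FILED at
rev 4 as a claimable support with its matured attack: nine triaged idea cards, trunk skeleton
Cruxes/DigitRung/Lines/Sketch.lean whose only unproved stub is FundDiscWeylSum (low-band stub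
landed: Theorems/ArithStatLadderDigitRungStubLow.lean), exact #Cl₃ for ALL fundamental −d < 2^32
with every middle-digit sum at the noise floor, Disproof.lean v10 (no 2-adic bias at any digit; det
Hess(Disc) = 3888·Disc²). R2 AcZeroRung (Walsh-twisted DH + a second-moment input; horizon, not an
item). Unlike FACT/DLOG the witness is FACTORING-INDEPENDENT (genus theory sees only the 2-part of
h), and unlike every other candidate family it has proved moments with local conditions — what
correlation methods consume; Cohen–Lenstra is the null model a classical predictor must beat
(AvgFaceBeyondPrior makes that the item).

Rationale: WHY THIS LINE. Imported areas: arithmetic statistics (Davenport–Heilbronn /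
Bhargava–Shankar–Tsimerman / Taniguchi–Thorne / Bhargava–Varma counting of cubic fields and
3-torsion, Cohen–Lenstra as the explicit prior) and reflection theorems (Scholz 1932; Hecke's
ramification criterion for Kummer extensions), pointed at the summit's witness form through ONE
factoring-independent language. WHY THIS FORM IS EASIER than "∃ L ∈ BQP ∖ BPP" — the classical
binder is summit-strength at this witness and says so (IqThreeNotBPP, AvgFaceBeyondPrior,
IqThreeNotPPoly are hypothesis-type, refuters first); what the witness buys: (1) the QUANTUM half
stops being a research problem — through the mirror it is a theorem whose every input is ALREADY
FORMALISED in the tree (Hallgren regulator, Jacobson–Williams residues, Shor: `_holds` theorems;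
transducer step landed), which no class-GROUP witness can say (DarkClassGroups /
LinnikCubicClassGroups must GENERATE class groups GRH-free — the hidden-GRH risk the tier list
named; units never needed GRH); (2) the CLASSICAL half lands in a theory with a distributional law —
an explicit prior (Cohen–Lenstra P(3 ∣ h) = 0.4399) and PROVED moments of 3-torsion with local
conditions — so restricted-adversary versions are theorems or sharply posed analytic statements,
closed by NAMED tools: BST Thm 20 / Cor 7, Taniguchi–Thorne Thm 1.5, BTT 2023 Thm 1.2 (⇒
EndJuntaRung and both ends of DigitRung), Bhargava–Varma Cor 4 (⇒ MirrorRankRare), LMN/Green-type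
Walsh bounds on the Boolean side; (3) it is cheaply and informatively KILLABLE on two independent
surfaces (digit / residue statistics of d; residues of ε_{ℚ(√3d)} mod 9), both under exact numerical
attack to 2^32. Dictionary: ensemble ↦ quadratic fields by |disc| (𝒟_n = n-bit d, −d fundamental;
U_n uniform); target bit ↦ 3 ∣ h(−d) ↦ (mirror) cube class of ε_{ℚ(√3d)} at 3 off a DH-rare set;
statistic ↦ T₃ − 2; trivial predictor ↦ Cohen–Lenstra prior; rung for class C ↦ equidistribution of
T₃ on C-definable sets; Heur-hardness ↦ "no efficient statistic of d beats the prior by 0.11".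

RANKED CRUXES (four; the opening protocol staffs these — everything else is support):
3 IqThreeMemBQP — IQ3 ∈ BQP unconditionally. Lead line scholz-mirror-siegel
(Cruxes/IqThreeMemBQP/Lines/scholz_mirror_siegel.lean, PICKED): RefinedScholz over the two landed
named facts + MirrorDichotomy (Landau: at most one field of the mirror pair (−d, 3d) is
Siegel-exceptional; provable from tree theorems `DirichletZFR.exists_landau_prodChar_min_le`,
`Siegel.caseA`) + the hardest stub `stub_realIdealClassOrder` = order of ONE ideal class of ℚ(√3d)
by Hallgren's ℤ×ℝ period finding (GRH-free, unpublished as such) — Monday's first lemma, over the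
self-delimited relation `realClassOrderRel` (Disproof.lean §6: bare-prefix order outputs are
unreadable for 3 ∣ ord). Shape M makes this crux OPTIONAL for the summit; it stays ranked as the one
crux here a lead can CLOSE outright and because W keeps the worst-case top X alive.
7 AvgFaceBeyondPrior — (IQ3, U) ∉ Heur_{1/3}BPP: no PPT algorithm is confidently right about 3 ∣
h(−d) on ≥ 2/3 of n-bit fundamental −d for every n (the prior predicts 0.56). Hypothesis-type (⇒ IQ3
∉ BPP ⇒ NP ⊄ BPP, 3 ∣ h having NP certificates); lead line mirror-unit-signature transports it
EXACTLY to the real face {UnitCubeAtThree d ∨ 3 ∣ h(ℚ(√3d))} and EARNS the shape-M supports (three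
of its stubs landed as Theorems files on 2026-08-16). In shape M it is the route's ONLY
hypothesis-type binder.
0 IqThreeNotBPP — the shape-W binder, derived from either top, never staffed directly. 0
IqThreeNotPPoly — X, the worst-case top (hypothesis-type; lead idea SQUAREFREES ≤ IQ3 by planted
binary cubic forms; helper files Theorems/ArithStatLadderIqThreeNotPPolyStub*.lean).
SUPPORTS (rank 9; claimable by plain provers, do not drive staffing): UnitCubeMemBQP (L; transducer
landed; remaining FB ∈ BQP from `factoring_mem_FBQP_holds`, CU ∈ BQP from Hallgren `_delim_holds` +
`stub_mirrorUnitData` + classical wrap), MirrorHeurTransfer (PROVED in the tree over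
`Negative.fundBlock` = this literal finset; a one-line re-typing closes it), MirrorAssembly (PROVED
in the planner's Sketch.lean, evidence attached), MirrorRankRare (proved in the tree modulo the
named fact `bv_threeTorsion_mean_localAtThree`; stated fact-free to keep the used-constants cone
clean), UnitCubeCriterion (textbook: Scholz + Hecke Satz 118–119 + Washington Thm 10.10 proof;
definitionally the named fact `ScholzHecke_unitCubeCriterion`, inlined for the same reason; the one
class-field-theory debt of BOTH shapes), EndJuntaRung (R0, in print), DigitRung (R1, re-filed
special case with a one-stub skeleton), NotBPPOfNotPPoly / NotBPPOfAvgFace (landed one-liners),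
Assembly (rev-2 shape, PROVED).

KILL CRITERIA. (i) h(−d) mod 3 ∈ BPP on fundamental −d (an ℓ = 3 genus theory / Rédei-symbol
formula, or a GRH-free polynomial descendant of Hafner–McCurley) refutes IqThreeNotBPP and
AvgFaceBeyondPrior at once: the route closes `refuted`. (ii) A PPT statistic of d confidently right
about 3 ∣ h(−d) on ≥ 2/3 of n-bit fundamental −d for all large n — IN PARTICULAR a classical
predictor of the cube class of ε_{ℚ(√3d)} mod 9 (the mirror is Heur_{1/6}-tight), or a detector of 3
∣ h(ℚ(√3d)) on a positive fraction — refutes AvgFaceBeyondPrior and shape M; W survives on X. (iii)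
X refuted (IQ3 ∈ P/poly) kills the worst-case top only. (iv) A proof that every GRH-free road to
IqThreeMemBQP needs Bach-type generation demotes W's quantum half to conditional — then M (no class
groups at all) is installed and nothing is conditional. (v) One fundamental −d with UnitCubeAtThree
d and 3 ∤ h(−d) (0 of 159 375 below 2^19) falsifies UnitCubeCriterion AS TYPED: a misstated-class
repair back to Hecke's 𝔓³ condition, not a substantive kill. (vi) A mid-digit bias of h₃ (none below
2^32) refutes DigitRung only; it gates nothing.

NOT DECOMPOSED YET. (a) Installing shape M: `closes (h₁ : UnitCubeCriterion) (h₂ : MirrorRankRare)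
(h₃ : AvgFaceBeyondPrior) : QuantumAdvantage := MirrorAssembly_proof h₁ h₂ UnitCubeMemBQP_proof
MirrorHeurTransfer_proof h₃` — one `route edit --closes-file` by the tenure planner once
UnitCubeMemBQP and MirrorAssembly are closed (UnitCubeCriterion and MirrorRankRare then re-kinded
crux: textbook CFT resp. DH-real with a 3-adic condition = the named-fact debts
`ScholzHecke_unitCubeCriterion`, `bv_threeTorsion_mean_localAtThree`); or the same as a sibling
route sharing AvgFaceBeyondPrior if W's lead is still moving. (b) The correlation apex PPolyRung (t
− 2 ⊥ poly-size circuits; `PPolyRung → X` kernel-checked) — filed only if the X line promotes it.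
(c) AcZeroRung (R2: 12 ideas, 3 checked lines, helper files
Theorems/ArithStatLadderAcZeroRung*.lean) and TC⁰ / AC⁰[⊕] rungs. (d) PSamp-domination (Kalai2003)
turning AvgFaceBeyondPrior into AvgCase's AvgThesis; a conditional `BachBoundGRH → IqThreeMemBQP`;
the card's calibration controls (negative Pell vs regulator bits; root number vs 2-Selmer).

CHEAPEST FALSIFIER. For the lever: one fundamental −d with UnitCubeAtThree d but 3 ∤ h(−d) (none
below 2^19; extending to 2^32 against the disprover's exact #Cl₃ tables is one batched job). For the
classical face: any polynomial-time statistic of d — digits, d mod 9/27, Rédei symbols / 4-rank of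
3d, continued-fraction period data of √d₀ — predicting 3 ∣ h(−d) or the unit cube class better than
the prior on n-bit fundamental −d (exact data to 2^32 in hand: only the X^{−1/6} secondary term
shows, walsh(0) = 0.347·X^{−1/6}; unit-residue tables:
Cruxes/AvgFaceBeyondPrior/Lines/mirror-unit-signature-numerics.md). For W's quantum half:
Cruxes/IqThreeMemBQP/Disproof.lean (§3: the mirror removes Bach generation rather than meeting it;
§6: bare-prefix order outputs cannot be read).

Novelty: NOVELTY. Nearest prior art FOUND: (1) classical hardness of class groups of RANDOM imaginary
quadratic discriminants with Cohen–Lenstra as prior — HamdyMoller2000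
(doi:10.1007/3-540-44448-3_18), BuchmannWilliams1988 (the average-case face ALONE = variant of
this); (2) the BQP side — Hallgren2005, Hallgren2007 (doi:10.1145/1206035.1206039), BiasseSong2015:
class groups under GRH (Bach generators); GRH-free only for regulators / units (Hallgren2007,
Jozsa2003), never pointed at class-number DIVISIBILITY; (3) the unit criterion itself — Scholz1932
(doi:10.1515/crll.1932.166.201), Hecke Satz 118–119, Washington1997 Thm 10.10, Honda 1968,
KishiMiyake2000 (doi:10.1006/jnth.1999.2455), Gras arXiv:2206.13931 Thm 7.1, Saikia 2020
(doi:10.1007/978-981-15-1514-9_6): all use "ε a cube at 3 ⇒ 3 ∣ h(−3D)" to CONSTRUCT or tabulate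
fields, none as an algorithm or as a hardness transfer; (4) the statistics engine —
BhargavaShankarTsimerman2012 (arXiv:1005.0672 Thm 20, Cor 7), TaniguchiThorne2013 (arXiv:1112.5030
Thm 1.5), BhargavaVarma2016 Cor 4, BhargavaTaniguchiThorne2023, BelabasBhargavaPomerance2010: they
PROVE R0, both ends of R1 and the 1/6 mirror bound, and were never read as lower bounds against
digit classes; (5) Green2012 (arXiv:1103.4991) + LinialMansourNisan1993 + sibling route MobiusLadder
— the correlation-ladder template (Möbius: factoring-computable, no distributional law); (6) sibling
routes DarkClassGroups / LinnikCubicClassGroups — GRH-free GENERATION of class groups (imagi  [refs: 10.1007/3-540-44448-3_18, 10.1145/1206035.1206039, 10.1515/crll.1932.166.201, 10.1006/jnth.1999.2455, 10.1007/978-981-15-1514-9_6, 10.1090/mcom3050, 2206.13931, 1005.0672, 1112.5030, 1103.4991, 1409.3177, 0812.0380, doi:10.1007/3-540-44448-3_18, doi:10.1145/1206035.1206039, doi:10.1515/crll.1932.166.201, doi:10.1006/jnth.1999.2455, doi:10.1007/978-981-15-1514-9_6, doi:10.1090/mcom3050, HamdyMoller]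

Barriers (technique_class: arithmetic-statistics, correlation-bounds, average-case): technique_class: arithmetic-statistics, correlation-bounds, average-case (also: reflection-theorems,
quantum-period-finding, non-natural)
- Literature.Barriers.QuantumAdvantage.SeparationPrerequisites: APPLIES, not evaded, and CONFINED —
exactly the hypothesis-type items IqThreeNotBPP / AvgFaceBeyondPrior / IqThreeNotPPoly carry
separation strength (with a BQP membership each yields BQP ⊄ BPP; AvgFaceBeyondPrior ⇒ IQ3 ∉ BPP ⇒
NP ⊄ BPP because 3 ∣ h(−d) has NP certificates, an element of order 3 among reduced forms). Nothing
else in either deciding shape is hypothesis-grade: UnitCubeMemBQP, MirrorHeurTransfer,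
MirrorAssembly are provable now (two already proved), UnitCubeCriterion / MirrorRankRare /
EndJuntaRung are printed theorems, DigitRung is an analytic equidistribution statement lying below
every uniform class separation.
- Literature.Barriers.QuantumAdvantage.NaturalProofs: APPLIES to X = IqThreeNotPPoly only (an
explicit P/poly lower bound; under the hard-PRG hypothesis of the PneNP catalogue no P/poly-natural
proof exists, `NaturalProofs.no_naturalProof_bqp_not_ppoly`) and would bite from a TC⁰ rung up
(Naor–Reingold PRFs in TC⁰). NOT engaged by the filed rungs (end-juntas, one digit, AC⁰: classes
without pseudorandom functions) nor by the property the engine uses ("agrees with the centred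
3-torsion along fundamental discriminants, equidistributed on congruence classes, intervals and Bohr
sets"): constructive only given the class numbers and not large — RazborovRudich

Novelty grade: new-combination — ROUTE REVIEW (refuter gen3 2026-08-15; consolidates c064b68f, 9bf55acc, 6bad857d g0-g2; per-item briefings on the items). STATEMENTS: all 7 decls rc0; IsFund literal correct under Int.emod/ediv (-3,-4,-8,-20 in; -12,0 out); classNumber = #reduced forms (proved bridge); t-hypothesis (3-torsion via an (refuter refuter-rreview-route-HubbardSuperconduc-6bad857d-g3-0, 2026-08-15T14:48:40Z; prior: doi:10.1007/3-540-44448-3_18, doi:10.1145/1206035.1206039, arXiv:1005.0672, arXiv:1112.5030, arXiv:1103.4991, doi:10.1215/00127094-2010-007, BhargavaVarma2016, BhargavaTaniguchiThorne2023, HeathbrownPierce2017, CohenLenstra1984, LinialMansourNisan1993, BiasseSong2015)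

History (route lifecycle, newest last):
- 2026-08-16T02:17:40Z · AUTO-CRUX: 1 conjecture-grade item(s) promoted to crux (AvgFaceBeyondPrior) — refuter vetting / tiering apply (operator:999:1362873)
- 2026-08-16T04:14:48Z · AUTO-CRUX (backfill): IqThreeNotPPoly — hypotheses of the deciding theorem that nothing in the route derives are cruxes (operator:999:1085951)
- 2026-08-16T06:37:07Z · rev 3: dropped DigitRung, AcZeroRung — route-repair (unused-crux): binder IqThreeNotPPoly→IqThreeNotBPP; AvgFaceBeyondPrior glued (NotBPPOfAvgFace, landed avgFace_imp_not_mem_BPP), X glued (NotBPPOfN (planner-rrepair-QuantumAdvantage-ArithStatLadd-f7a59c35-0)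
- 2026-08-16T06:38:32Z · AUTO-CRUX (edit): IqThreeNotBPP — hypotheses of the deciding theorem that nothing in the route derives are cruxes (planner-rrepair-QuantumAdvantage-ArithStatLadd-f7a59c35-0)
- 2026-08-22T02:06:15Z · DORMANT — reconciler: no traction for 5 d (last activity item-evidence-added at 2026-08-17T01:20:37Z); parked, not closed — `ledger route dormant route-QuantumAdvantage-A (operator:999:908377)

sub-problem: QuantumAdvantage · status: dormant · opened planner-plancard-QuantumAdvantage-QuantumAdva-a3e0705c-0 2026-08-15T11:04:09Z · rev 6 · ledger route-QuantumAdvantage-ArithStatLadder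
GENERATED by the gate from the ledger (D-0016/17). Provers cite these decls: `theorem foo : Summit.QuantumAdvantage.QuantumAdvantage.Theses.ArithStatLadder.<Decl> := …` in Summits/QuantumAdvantage/QuantumAdvantage/Theorems/<Name>.lean.
-/

namespace Summit.QuantumAdvantage.QuantumAdvantage.Theses.ArithStatLadder

open scoped BigOperators Topology Manifold Classical MeasureTheory ProbabilityTheory Matrix InnerProductSpace ComplexConjugate ContinuousMap
open Filter Set Function TopologicalSpace MeasureTheory

attribute [summit_statement] _root_.QuantumAdvantage

open Literature.QuantumAdvantage

/-- item stmt-QuantumAdvantage-14864 · crux (kind.auto-crux: conjecture-grade) · rank 0 · open · by planner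
why it might fail: False if h(−d) mod 3 on fundamental −d is in BPP: an ℓ=3 analogue of genus theory / Rédei symbols, a classical formula for the cube class of ε_{ℚ(√3d)} mod 9 (by the mirror that already decides IQ3 on 5/6 of inputs), or a GRH-free poly-time descendant of Hafner–McCurley's L(1/2) algorithm.
sources: HafnerMccurley1989, BuchmannWilliams1988, HamdyMoller2000, Scholz1932, Literature.Barriers.QuantumAdvantage.SeparationPrerequisites
[target] The summit's classical conjunct at the witness: IQ3 = { bin(d) : −d fundamental
discriminant, 3 ∣ h(−d) } (LSB-first `encodingNatBool`; h = `BinaryQuadraticForm.classNumber` =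
|Cl(O_K)| by the PROVED `card_reducedForms_eq_classNumber`; fundamentality literal as in the sibling
items) is decided by NO probabilistic polynomial-time machine (tree class
`Literature.Computability.Complexity.BPP = bp P`, error ≤ 1/3). This is exactly what `closes`
consumes (rev 3 binder: `closes (h₁ : IqThreeMemBQP) (h₂ : IqThreeNotBPP) : QuantumAdvantage := ⟨_,
h₁, h₂⟩`). DERIVED, never staffed for a direct proof: from X = IqThreeNotPPoly by Adleman (support
NotBPPOfNotPPoly, `BPP_subset_PPoly_holds`) and from the average-case face AvgFaceBeyondPrior
(support NotBPPOfAvgFace, landed `Theorems.AvgFaceBeyondPrior.Negative.avgFace_imp_not_mem_BPP`).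
Hypothesis-type (separation strength: with IqThreeMemBQP it IS BQP ⊄ BPP; since h(−d) =
#reducedForms(−d) is a #P count it also gives FP ≠ #P-type consequences); refuters first. Refutation
surface = a BPP algorithm for h(−d) mod 3 on fundamental −d (best known: L(1/2) subexponential under
GRH, HafnerMcCurley1989; imaginary-quadratic cryptography assumes -/
@[route_item "route-QuantumAdvantage-ArithStatLadder", crux]
def IqThreeNotBPP : Prop :=
  Computability.encodingNatBool.toLanguage {d : ℕ | (((-(d:ℤ)) % 4 = 1 ∧ Squarefree (-(d:ℤ)) ∧ (-(d:ℤ)) ≠ 1) ∨ (4 ∣ (-(d:ℤ)) ∧ ((-(d:ℤ)) / 4 % 4 = 2 ∨ (-(d:ℤ)) / 4 % 4 = 3) ∧ Squarefree ((-(d:ℤ)) / 4))) ∧ 3 ∣ Literature.NumberTheory.QuadraticFields.BinaryQuadraticForm.classNumber (-(d:ℤ))} ∉ Literature.Computability.Complexity.BPP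

/-- item stmt-QuantumAdvantage-2422 · crux (kind.auto-crux: conjecture-grade) · rank 0 · open · by planner
why it might fail: Stronger than the binder (non-uniform): false if poly-size circuits compute h(−d) mod 3 — factoring advice buys nothing known, but an ℓ=3 'genus theory' or a table-free formula for the mirror unit's cube class would do it; under hard PRGs no P/poly-natural proof exists (NaturalProofs).
sources: RazborovRudich1997, Scholz1932, HamdyMoller2000, Cox2013, Literature.Barriers.QuantumAdvantage.NaturalProofs, Literature.Barriers.QuantumAdvantage.SeparationPrerequisites
[target] Thesis X (top rung): IQ3 = { bin(d) : −d fundamental discriminant, 3 ∣ h(−d) } (LSB-first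
`encodingNatBool`; h = `BinaryQuadraticForm.classNumber` = |Cl(O_K)|, K = ℚ(√−d), by the PROVED
`card_reducedForms_eq_classNumber`, Cox2013 Thm 7.7; fundamentality spelled out as in
QuadraticFields/FundamentalDiscriminant.lean) has no polynomial-size circuit family. Hypothesis-type
(cf. CircuitLB.ClbFactNotPpoly, MobiusLadder.LiouvilleNotPPoly) but FACTORING-INDEPENDENT: no
classical algorithm for h(−d) mod 3 is known even given the factorisation of d (genus theory sees
only the 2-part; Scholz1932 reflection ties the 3-part to ℚ(√3d); Hasse1930 / BST §8.5 to cubic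
fields of discriminant −d); classical hardness of class groups of random discriminants is the
standing assumption of imaginary-quadratic cryptography (BuchmannWilliams1988, HamdyMoller2000).
With IqThreeMemBQP and Adleman it gives the summit (Assembly). The rungs below (EndJuntaRung in
print ⊂ DigitRung ⊂ AcZeroRung) are its unconditional average-case shadows against growing classes
of digit functions. Refuters first; do not staff provers. -/
@[route_item "route-QuantumAdvantage-ArithStatLadder"]
def IqThreeNotPPoly : Prop :=
  Computability.encodingNatBool.toLanguage {d : ℕ | (((-(d:ℤ)) % 4 = 1 ∧ Squarefree (-(d:ℤ)) ∧ (-(d:ℤ)) ≠ 1) ∨ (4 ∣ (-(d:ℤ)) ∧ ((-(d:ℤ)) / 4 % 4 = 2 ∨ (-(d:ℤ)) / 4 % 4 = 3) ∧ Squarefree ((-(d:ℤ)) / 4))) ∧ 3 ∣ Literature.NumberTheory.QuadraticFields.BinaryQuadraticForm.classNumber (-(d:ℤ))} ∉ Literature.Computability.Complexity.PPoly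

/-- item stmt-QuantumAdvantage-2424 · crux · rank 3 · open · by planner
why it might fail: Unconditional as typed: printed algorithms need Bach-bound generators (GRH). The GRH-free picked line needs (a) the order of ONE real-quadratic ideal class via Hallgren's ℤ×ℝ period finding, unpublished as such, and (b) Landau's one-exceptional-field dichotomy; (a) may hide a precision obstruction.
sources: Hallgren2005, Hallgren2007, BiasseSong2015, Bach1990, Scholz1932, ChildsVandam2010
[crux] The quantum half: IQ3 ∈ BQP (tree's strict class: P-uniform Clifford+T families, error ≤
1/3). In print UNDER GRH: generators of Cl(ℚ(√−d)) from prime forms of norm ≤ 6 log²d (Bach's bound)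
+ abelian group decomposition on the form class group with unique reduced representatives
(Cheung–Mosca; Hallgren2005; BiasseSong2015 in arbitrary degree; survey ChildsVandam2010 §5.7 p.24:
'efficient quantum algorithm for decomposing Cl(K) provided K has constant degree and assuming the
GRH [Hal05]'), read |Cl| mod 3; fundamentality of −d by factoring d (Shor1997). Filed as a CRUX, not
a fact-hypothesis: (i) the unconditional statement needs GRH-free generation of class groups — open,
and exactly the mechanism of the sibling card dark-class-groups (quantum factoring of b² + d yields
random reduced forms); (ii) it exercises the same uniform-family composition API as route Shor
(stmt-QuantumAdvantage-0233/0234). A conditional support `BachBoundGRH → IQ3 ∈ BQP` may be filed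
once a GRH named fact exists (cite item filed). Phase-C rule: the one Assembly antecedent resting on
an unlanded fact, ranked right after the lead analytic crux. -/
@[route_item "route-QuantumAdvantage-ArithStatLadder", crux]
def IqThreeMemBQP : Prop :=
  Computability.encodingNatBool.toLanguage {d : ℕ | (((-(d:ℤ)) % 4 = 1 ∧ Squarefree (-(d:ℤ)) ∧ (-(d:ℤ)) ≠ 1) ∨ (4 ∣ (-(d:ℤ)) ∧ ((-(d:ℤ)) / 4 % 4 = 2 ∨ (-(d:ℤ)) / 4 % 4 = 3) ∧ Squarefree ((-(d:ℤ)) / 4))) ∧ 3 ∣ Literature.NumberTheory.QuadraticFields.BinaryQuadraticForm.classNumber (-(d:ℤ))} ∈ Literature.Computability.Cryptography.BQP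

/-- item stmt-QuantumAdvantage-2427 · crux (kind.auto-crux: conjecture-grade) · rank 7 · open · by planner
why it might fail: False if ANY PPT statistic of d is confidently right about 3∣h(−d) on ≥ 2/3 of n-bit fundamental −d for all n: in mirror coordinates a classical predictor of the cube class of ε_{ℚ(√3d)} mod 9 (Heur_{1/6}-tight) or of 3∣h(ℚ(√3d)), or digit/residue statistics beating the 0.56 prior by 0.11.
sources: CohenLenstra1984, HamdyMoller2000, BhargavaVarma2016, Scholz1932, BogdanovTrevisan2006, Kalai2003
[support] Average-case face RELATIVE TO THE COHEN–LENSTRA PRIOR (hypothesis-type; refuters first, do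
not staff provers): on the natural ensemble U_n = uniform n-bit d with −d fundamental (inline PMF;
within 2^{−n} of a PSamp ensemble via Kalai2003's uniformly random FACTORED integers + rejection),
(IQ3, U) ∉ HeurDeltaBPP(1/3): no PPT algorithm is confidently correct (coin-error < 1/4) on ≥ 2/3 of
n-bit fundamental discriminants for every n. The constant predictor '3 ∤ h' errs with conjectural
probability 1 − ∏_{i≥1}(1 − 3^{−i}) = 0.43987 (CohenLenstra1984, LNM 1068 p.33, (C2)) — itself OPEN
(only the mean of 3^{r_3} is a theorem, p.51 (C6), Davenport–Heilbronn) — so δ = 1/3 says 'no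
efficient statistic of d beats the prior by 0.11', robust to the secondary-term drift of empirical
frequencies. Implies (IQ3, U) ∉ HeurBPP (m = 3): the input route AvgCase needs once U is replaced by
a dominating PSamp ensemble and IqThreeMemBQP lands. Language-level, prior-explicit form of the
folklore of imaginary-quadratic cryptography (BuchmannWilliams1988; HamdyMoller2000: random
discriminants, Cohen–Lenstra as prior), graded VARIANT alone by the novelty audit — hence support. -/
@[route_item "route-QuantumAdvantage-ArithStatLadder", crux]
def AvgFaceBeyondPrior : Prop :=
  (⟨Computability.encodingNatBool.toLanguage {d : ℕ | (((-(d:ℤ)) % 4 = 1 ∧ Squarefree (-(d:ℤ)) ∧ (-(d:ℤ)) ≠ 1) ∨ (4 ∣ (-(d:ℤ)) ∧ ((-(d:ℤ)) / 4 % 4 = 2 ∨ (-(d:ℤ)) / 4 % 4 = 3) ∧ Squarefree ((-(d:ℤ)) / 4))) ∧ 3 ∣ Literature.NumberTheory.QuadraticFields.BinaryQuadraticForm.classNumber (-(d:ℤ))}, (fun n : ℕ => if h : ((Finset.Ico (2 ^ (n - 1)) (2 ^ n)).filter (fun d : ℕ => (((-(d:ℤ)) % 4 = 1 ∧ Squarefree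 (-(d:ℤ)) ∧ (-(d:ℤ)) ≠ 1) ∨ (4 ∣ (-(d:ℤ)) ∧ ((-(d:ℤ)) / 4 % 4 = 2 ∨ (-(d:ℤ)) / 4 % 4 = 3) ∧ Squarefree ((-(d:ℤ)) / 4))))).Nonempty then (PMF.uniformOfFinset ((Finset.Ico (2 ^ (n - 1)) (2 ^ n)).filter (fun d : ℕ => (((-(d:ℤ)) % 4 = 1 ∧ Squarefree (-(d:ℤ)) ∧ (-(d:ℤ)) ≠ 1) ∨ (4 ∣ (-(d:ℤ)) ∧ ((-(d:ℤ)) / 4 % 4 = 2 ∨ (-(d:ℤ)) / 4 % 4 = 3) ∧ Squarefree ((-(d:ℤ)) / 4))))) h).map Computability.encodeNat else PMF.pure [])⟩ : Literature.Computability.MetaComplexity.DistProblem) ∉ Literature.Computability.MetaComplexity.HeurDeltaBPP (fun _ => (1 : ℝ) / 3)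

/-- item stmt-QuantumAdvantage-2426 · support · rank 6 · open · by planner
sources: BhargavaShankarTsimerman2012, arXiv:1005.0672, TaniguchiThorne2013, TaniguchiThorne2013Orbital, arXiv:1112.5030, BhargavaVarma2016
[support] First rung, IN PRINT modulo bookkeeping (provable once DH-with-congruences is a Literature
named fact; cite item filed): ∀ k, ε > 0, large n, pattern a: the cylinder fixing the k lowest and k
highest bits of d has |Σ_{d∈𝒟_n∩cyl(a)}(t(−d) − 2)| ≤ ε·#𝒟_n; so t − 2 ⊥ every junta on O(1) end
digits. Proof in print: low bits = class of −d mod 2^k, high bits = one of 2^k dyadic subintervals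
of [2^{n−1}, 2^n); arXiv:1005.0672 Thm 20 (§5.5: congruence conditions mod m on binary cubic forms,
error O(k m^{−3}X^{5/6}) + O(X^{3/4+ε})) with §8.5 (class field theory: Σ_{−X<D<0}(h_3^*(D) − 1)/2 =
N(𝒱 ∩ V^{(1)}; X)) and the maximality sieve; or directly TaniguchiThorne2013's AP theorem for
Σ_{Disc F ≡ a (m)} #Cl_3(F) (arXiv:1112.5030 Thm 1.5; 4 ∣ m treated). Mean 2 in EVERY class: the
discriminant of a random maximal nowhere-totally-ramified cubic ℤ_2-algebra is uniform over
fundamental 2-adic discriminants (weights 1/6 + 1/3 on squares vs 1/2 on 5 mod 8; ramified classes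
pair up) — the local computation behind BhargavaVarma2016's insensitivity to local conditions. NB a
class mod 2^k, k ≥ 6, is finer than a local specification at 2 (BST Thm 5/6), hence Thm 20/TT rather
than Cor. 7. -/
@[route_item "route-QuantumAdvantage-ArithStatLadder"]
def EndJuntaRung : Prop :=
  ∀ t : ℤ → ℕ, (∀ (D : ℤ) (K : Type) [Field K] [NumberField K], Module.finrank ℚ K = 2 → NumberField.discr K = D → t D = Nat.card {c : ClassGroup (NumberField.RingOfIntegers K) // c ^ 3 = 1}) → ∀ k : ℕ, ∀ ε : ℝ, 0 < ε → ∀ᶠ n : ℕ in Filter.atTop, ∀ a : ℕ → Bool, |∑ d ∈ ((Finset.Ico (2 ^ (n - 1)) (2 ^ n)).filter (fun d : ℕ => (((-(d:ℤ)) % 4 = 1 ∧ Squarefree (-(d:ℤ)) ∧ (-(d:ℤ)) ≠ 1) ∨ (4 ∣ (-(d:ℤ)) ∧ ((-(d:ℤ)) / 4 % 4 = 2 ∨ (-(d:ℤ)) / 4 % 4 = 3) ∧ Squarefree ((-(d:ℤ)) / 4))))).filter (fun d : ℕ => ∀ i < n, (i < k ∨ n ≤ i + k) → Nat.testBit d i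 = a i), ((t (-(d:ℤ)) : ℝ) - 2)| ≤ ε * (((Finset.Ico (2 ^ (n - 1)) (2 ^ n)).filter (fun d : ℕ => (((-(d:ℤ)) % 4 = 1 ∧ Squarefree (-(d:ℤ)) ∧ (-(d:ℤ)) ≠ 1) ∨ (4 ∣ (-(d:ℤ)) ∧ ((-(d:ℤ)) / 4 % 4 = 2 ∨ (-(d:ℤ)) / 4 % 4 = 3) ∧ Squarefree ((-(d:ℤ)) / 4))))).card : ℝ)

/-- item stmt-QuantumAdvantage-14865 · support · rank 9 · closed · proved by Summit.QuantumAdvantage.QuantumAdvantage.Theorems.ArithStatLadder.NotBPPOfNotPPoly_proof @ 5ec35a94adf0 (prover) · by planner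
sources: Adleman1978, AroraBarakCC2009
[support] Glue making X feed the binder: IQ3 ∉ P/poly ⇒ IQ3 ∉ BPP, by Adleman's BPP ⊆ P/poly (PROVED
in the tree: `Literature.Computability.Complexity.BPP_subset_PPoly_holds`). Provable NOW, one line,
kernel-checked in the planner's Sketch.lean: `fun h hB => h (BPP_subset_PPoly_holds hB)`. [deps:
IqThreeNotPPoly, IqThreeNotBPP] [difficulty: provable-now] -/
@[route_item "route-QuantumAdvantage-ArithStatLadder"]
def NotBPPOfNotPPoly : Prop :=
  IqThreeNotPPoly → IqThreeNotBPP

/-- item stmt-QuantumAdvantage-14866 · support · rank 9 · closed · proved by Summit.QuantumAdvantage.QuantumAdvantage.Theorems.ArithStatLadder.NotBPPOfAvgFace_proof @ eabdfb0950d9 (prover) · by planner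
sources: BogdanovTrevisan2006, AroraBarakCC2009
[support] Glue making the average-case face feed the binder: (IQ3, U) ∉ HeurDeltaBPP(1/3) ⇒ IQ3 ∉
BPP, because (L ∈ BPP) ⇒ (L, 𝒟) ∈ Heur_δBPP for every ensemble 𝒟 and every δ ≥ 0 (amplify to error ≤
1/8, truncate coins, lift to (x, 1ⁿ); BogdanovTrevisan2006 §2.3). Provable NOW: it is the landed
theorem
`Summit.QuantumAdvantage.QuantumAdvantage.Theorems.AvgFaceBeyondPrior.Negative.avgFace_imp_not_mem_BPP`
(Theorems/AvgFaceBeyondPrior/Negative/AvgFaceBeyondPriorNecessary.lean, via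
`mem_HeurDeltaBPP_of_mem_BPP`), re-stated against the route decls; kernel-checked in the planner's
Sketch.lean: `fun h => avgFace_imp_not_mem_BPP h`. [deps: AvgFaceBeyondPrior, IqThreeNotBPP]
[difficulty: provable-now] -/
@[route_item "route-QuantumAdvantage-ArithStatLadder"]
def NotBPPOfAvgFace : Prop :=
  AvgFaceBeyondPrior → IqThreeNotBPP

/-- item stmt-QuantumAdvantage-15003 · support · rank 9 · closed · proved by Summit.QuantumAdvantage.QuantumAdvantage.Theorems.ArithStatLadder.UnitCubeCriterion_proof @ 8ae6aa75ea30 (prover) · by planner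
sources: Scholz1932, Washington1997, JacobsonWilliams2008, doi:10.1006/jnth.1999.2455, arXiv:2206.13931
[support] TEXTBOOK THEOREM (printed; XL to formalise): the Scholz–Hecke unit criterion for the
mirror pair (ℚ(√3d), ℚ(√−d)) — for −d fundamental, d ≠ 3: (i) if the fundamental unit ε = (a+b√d₀)/2
of ℚ(√3d) (d₀ = squarefree kernel of 3d) is a cube at 3, in the elementary spelling (a+b√d₀)⁸ = X +
Y√d₀ with X ≡ 4 (mod 9) and 9 ∣ Y (3 ∣ d) resp. 3 ∣ Y (3 ∤ d), then 3 ∣ h(−d); (ii) if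
#Cl(ℚ(√3d))[3] = 1 then conversely 3 ∣ h(−d) forces the unit to be a cube at 3 (Kummer theory over
ℚ(√−d, ζ₃): V_k = ⟨ε⟩ has dimension r₃(k)+1 = 1; ramification at 3 by Hecke Satz 118–119, e(𝔓∣3) =
2, modulus 𝔓³). DEFINITIONALLY EQUAL (Iff.rfl, checked in the planner's Sketch.lean) to the
Literature named fact `Literature.NumberTheory.QuadraticFields.ScholzHecke_unitCubeCriterion`
(QuadraticFields/ScholzHeckeUnitCriterion.lean); INLINED here on purpose so that the unproved fact
constant stays out of the route's used-constants cone (staffability) — the item closes by `:=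
ScholzHecke_unitCubeCriterion_holds` the day that fact is discharged. Certified AS TYPED: 0
violations of (i) and (ii) on all 159 375 fundamental −d with d < 2^19 (kit j012491) and 0/112 031
in three independent ideal-theoretic implementati -/
@[route_item "route-QuantumAdvantage-ArithStatLadder"]
def UnitCubeCriterion : Prop :=
  ∀ d : ℕ, (((-(d:ℤ)) % 4 = 1 ∧ Squarefree (-(d:ℤ)) ∧ (-(d:ℤ)) ≠ 1) ∨ (4 ∣ (-(d:ℤ)) ∧ ((-(d:ℤ)) / 4 % 4 = 2 ∨ (-(d:ℤ)) / 4 % 4 = 3) ∧ Squarefree ((-(d:ℤ)) / 4))) → d ≠ 3 → (let d₀ : ℕ := (if 3 ∣ d then (if 4 ∣ d then d / 12 else d / 3) else (if 4 ∣ d then 3 * (d / 4) else 3 * d)); let U : Prop := (∃ a b : ℕ, (0 < b ∧ ((a:ℤ) ^ 2 - (d₀:ℤ) * (b:ℤ) ^ 2 = 4 ∨ (a:ℤ) ^ 2 - (d₀:ℤ) * (b:ℤ) ^ 2 = -4) ∧ ∀ a' b' : ℕ, 0 < b' → ((a':ℤ) ^ 2 - (d₀:ℤ) * (b':ℤ)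 ^ 2 = 4 ∨ (a':ℤ) ^ 2 - (d₀:ℤ) * (b':ℤ) ^ 2 = -4) → a ≤ a') ∧ ((⟨(a:ℤ), (b:ℤ)⟩ : Zsqrtd (d₀:ℤ)) ^ 8).re % 9 = 4 ∧ (3 ∣ d → (9:ℤ) ∣ ((⟨(a:ℤ), (b:ℤ)⟩ : Zsqrtd (d₀:ℤ)) ^ 8).im) ∧ (¬ 3 ∣ d → (3:ℤ) ∣ ((⟨(a:ℤ), (b:ℤ)⟩ : Zsqrtd (d₀:ℤ)) ^ 8).im)); (U → 3 ∣ Literature.NumberTheory.QuadraticFields.BinaryQuadraticForm.classNumber (-(d:ℤ))) ∧ (Literature.NumberTheory.QuadraticFields.quadFieldThreeTorsion (if 3 ∣ d then ((d / 3 : ℕ) : ℤ) else 3 * (d : ℤ)) = 1 → 3 ∣ Literature.NumberTheory.QuadraticFields.BinaryQuadraticForm.classNumber (-(d:ℤ)) → U))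

/-- item stmt-QuantumAdvantage-15004 · support · rank 9 · open · by planner
sources: BhargavaVarma2016, DavenportHeilbronn1971, BhargavaShankarTsimerman2012
[support] PRINTED THEOREM modulo one cite input (Davenport–Heilbronn for real quadratic fields with
a 3-adic local condition = Bhargava–Varma 2016 Cor. 4(b) + Lemma 37(a)): 3-torsion of the MIRROR
field is rare — for every ε > 0, eventually in n, at most (1/6 + ε)·#𝒟_n of the d ∈ 𝒟_n (n-bit d, −d
fundamental) have #Cl(ℚ(√3d))[3] ≠ 1 (mirror discriminant D⁺ = d/3 if 3 ∣ d, 3d otherwise;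
`quadFieldThreeTorsion D⁺ ≠ 1`). PROVED IN THE TREE modulo its two named-fact hypotheses as
`Summit.QuantumAdvantage.QuantumAdvantage.Theorems.AvgFaceBeyondPrior.Mirror.stub_mirrorRankRare :
bv_threeTorsion_mean_localAtThree → bv_count_posFundDiscrs_localAtThree → (this statement over
Negative.fundBlock = this literal finset)`
(Theorems/ArithStatLadderAvgFaceBeyondPriorMirrorRankRare.lean: d ↦ D⁺ bijections onto the two BV
families, window differencing, Markov with #Cl₃ ≠ 1 ⇒ #Cl₃ ≥ 3);
`bv_count_posFundDiscrs_localAtThree_holds` is proved, so the item closes by one line the day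
`bv_threeTorsion_mean_localAtThree` (ThreeTorsionMeanLocalAtThree.lean) is discharged. Stated
FACT-FREE on purpose (the unproved named fact must not enter the route's used-constants cone).
Cohen–Lenstra value of the density: -/
@[route_item "route-QuantumAdvantage-ArithStatLadder", crux]
def MirrorRankRare : Prop :=
  ∀ ε : ℝ, 0 < ε → ∀ᶠ n : ℕ in Filter.atTop, (((((Finset.Ico (2 ^ (n - 1)) (2 ^ n)).filter (fun d : ℕ => (((-(d:ℤ)) % 4 = 1 ∧ Squarefree (-(d:ℤ)) ∧ (-(d:ℤ)) ≠ 1) ∨ (4 ∣ (-(d:ℤ)) ∧ ((-(d:ℤ)) / 4 % 4 = 2 ∨ (-(d:ℤ)) / 4 % 4 = 3) ∧ Squarefree ((-(d:ℤ)) / 4))))).filter (fun d : ℕ => Literature.NumberTheory.QuadraticFields.quadFieldThreeTorsion (if 3 ∣ d then ((d / 3 : ℕ) : ℤ) else 3 * (d : ℤ)) ≠ 1)).card : ℝ)) ≤ (1 / 6 + ε) * (((Finset.Ico (2 ^ (n - 1)) (2 ^ n)).filter (fun d : ℕ => (((-(d:ℤ)) % 4 = 1 ∧ Squarefree (-(d:ℤ))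 ∧ (-(d:ℤ)) ≠ 1) ∨ (4 ∣ (-(d:ℤ)) ∧ ((-(d:ℤ)) / 4 % 4 = 2 ∨ (-(d:ℤ)) / 4 % 4 = 3) ∧ Squarefree ((-(d:ℤ)) / 4))))).card : ℝ)

/-- item stmt-QuantumAdvantage-15005 · support · rank 9 · closed · proved by Summit.QuantumAdvantage.QuantumAdvantage.Theorems.ArithStatLadder.UnitCubeMemBQP_proof (prover) · by planner
sources: Hallgren2007, Jozsa2003, JacobsonWilliams2008, Shor1997
[support] PROVABLE NOW (L; every mathematical input is a PROVED tree theorem, no Riemann hypothesis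
anywhere): the unit-cube language L_ε = bin{d : −d fundamental, d ≠ 3, UnitCubeAtThree d} is in BQP
(the tree's strict class) — the quantum witness of the GRH-free deciding shape M. The unit predicate
is INLINED (definitionally `Literature.NumberTheory.QuadraticFields.UnitCubeAtThree d`, Iff.rfl in
the planner's Sketch.lean; inlined only to avoid importing ScholzHeckeUnitCriterion.lean into the
route file, whose local copies in the line files would become ambiguous). Algorithm: (1) decide
fundamentality of −d via the factorisation of d (`factoring_mem_FBQP_holds` / `FACT_mem_BQP_holds`,
Shor); (2) d₀ = mirrorRadicand d (FP); (3) Hallgren: an integer within 1 of the regulator of ℚ(√d₀)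
— FORMALISED, `Literature.Computability.Cryptography.Hallgren2007_regulator_qsolvable_delim_holds`
(HallgrenPellQuantum.lean, Hallgren 2007 via Jozsa 2003 Thm 7, NO GRH); (4) Jacobson–Williams: (a
mod 9, b mod 9) of the fundamental unit (a+b√d₀)/2 from (d₀, r) — PROVED,
`JacobsonWilliams2008_unitResidue_mem_FP_holds`; the linking data lemma LANDED as
`Mirror.stub_mirrorUnitData` (Theorems/ArithStatLadde -/
@[route_item "route-QuantumAdvantage-ArithStatLadder"]
def UnitCubeMemBQP : Prop :=
  Computability.encodingNatBool.toLanguage {d : ℕ | ((((-(d:ℤ)) % 4 = 1 ∧ Squarefree (-(d:ℤ)) ∧ (-(d:ℤ)) ≠ 1) ∨ (4 ∣ (-(d:ℤ)) ∧ ((-(d:ℤ)) / 4 % 4 = 2 ∨ (-(d:ℤ)) / 4 % 4 = 3) ∧ Squarefree ((-(d:ℤ)) / 4))) ∧ d ≠ 3 ∧ (let d₀ : ℕ := (if 3 ∣ d then (if 4 ∣ d then d / 12 else d / 3) else (if 4 ∣ d then 3 * (d / 4) else 3 * d)); ∃ a b : ℕ, (0 < b ∧ ((a:ℤ) ^ 2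 - (d₀:ℤ) * (b:ℤ) ^ 2 = 4 ∨ (a:ℤ) ^ 2 - (d₀:ℤ) * (b:ℤ) ^ 2 = -4) ∧ ∀ a' b' : ℕ, 0 < b' → ((a':ℤ) ^ 2 - (d₀:ℤ) * (b':ℤ) ^ 2 = 4 ∨ (a':ℤ) ^ 2 - (d₀:ℤ) * (b':ℤ) ^ 2 = -4) → a ≤ a') ∧ ((⟨(a:ℤ), (b:ℤ)⟩ : Zsqrtd (d₀:ℤ)) ^ 8).re % 9 = 4 ∧ (3 ∣ d → (9:ℤ) ∣ ((⟨(a:ℤ), (b:ℤ)⟩ : Zsqrtd (d₀:ℤ)) ^ 8).im) ∧ (¬ 3 ∣ d → (3:ℤ) ∣ ((⟨(a:ℤ), (b:ℤ)⟩ : Zsqrtd (d₀:ℤ)) ^ 8).im)))} ∈ Literature.Computability.Cryptography.BQP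

/-- item stmt-QuantumAdvantage-15006 · support · rank 9 · closed · proved by Summit.QuantumAdvantage.QuantumAdvantage.Theorems.ArithStatLadder.MirrorHeurTransfer_proof (prover) · by planner
sources: BogdanovTrevisan2006, AroraBarakCC2009
[support] PROVED IN THE TREE (closing this item is a one-line re-typing): the mirror transfer — if a
set T ⊆ ℕ agrees with IQ3 (3 ∣ h(−d)) off a (1/6 + ε)-fraction of every late block 𝒟_n, for every ε
> 0, and bin T ∈ BPP, then (IQ3, U) ∈ Heur_{1/3}BPP, i.e. ¬AvgFaceBeyondPrior. Proof (landed
sorry-free as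
`Summit.QuantumAdvantage.QuantumAdvantage.Theorems.AvgFaceBeyondPrior.Mirror.stub_heurTransfer`,
Theorems/ArithStatLadderAvgFaceBeyondPriorHeurTransfer.lean, stated over `Negative.fundBlock n` =
definitionally this literal finset): amplify the BPP machine to error ≤ 1/8 (`BPP_subset_bpErr` /
`exists_randAlg_error_le_of_mem_BPP_holds`), truncate coins and lift to (x, 1ⁿ) as in the landed
`Negative.mem_HeurDeltaBPP_of_mem_BPP` (`paramLift`); from the agreement level n₀ on, the bad set
(coin error ≥ 1/4 about IQ3) sits inside bin of the disagreement filter, of U_n-mass ≤ 1/6 + 1/6 =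
1/3 (`Negative.ens_prob_eq`); below n₀ patch with the finite table of IQ3 (FP table functions), bad
mass 0, the `pure []` levels n ≤ 1 included (`Negative.nil_not_mem_iq3Lang`). Role: the glue of
shape M (antecedent of MirrorAssembly) and the refutation surface
`not_avgFace_of_unitCubeLang_mem_BPP` (a cl -/
@[route_item "route-QuantumAdvantage-ArithStatLadder"]
def MirrorHeurTransfer : Prop :=
  ∀ T : Set ℕ, (∀ ε : ℝ, 0 < ε → ∀ᶠ n : ℕ in Filter.atTop, (((((Finset.Ico (2 ^ (n - 1)) (2 ^ n)).filter (fun d : ℕ => (((-(d:ℤ)) % 4 = 1 ∧ Squarefree (-(d:ℤ)) ∧ (-(d:ℤ)) ≠ 1) ∨ (4 ∣ (-(d:ℤ)) ∧ ((-(d:ℤ)) / 4 % 4 = 2 ∨ (-(d:ℤ)) / 4 % 4 = 3) ∧ Squarefree ((-(d:ℤ)) / 4))))).filter (fun d : ℕ => ¬ (3 ∣ Literature.NumberTheory.QuadraticFields.BinaryQuadraticForm.classNumber (-(d:ℤ)) ↔ d ∈ T))).card : ℝ)) ≤ (1 / 6 + ε) * (((Finset.Ico (2 ^ (n - 1)) (2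 ^ n)).filter (fun d : ℕ => (((-(d:ℤ)) % 4 = 1 ∧ Squarefree (-(d:ℤ)) ∧ (-(d:ℤ)) ≠ 1) ∨ (4 ∣ (-(d:ℤ)) ∧ ((-(d:ℤ)) / 4 % 4 = 2 ∨ (-(d:ℤ)) / 4 % 4 = 3) ∧ Squarefree ((-(d:ℤ)) / 4))))).card : ℝ)) → Computability.encodingNatBool.toLanguage T ∈ Literature.Computability.Complexity.BPP → ¬ AvgFaceBeyondPrior

/-- item stmt-QuantumAdvantage-15007 · support · rank 9 · closed · proved by Summit.QuantumAdvantage.QuantumAdvantage.Theorems.ArithStatLadder.MirrorAssembly_proof (prover) · by planner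
sources: Scholz1932, BhargavaVarma2016, Hallgren2007, BogdanovTrevisan2006
[support] GLUE OF THE GRH-FREE DECIDING SHAPE M, PROVABLE NOW (kernel-checked sorry-free in the
planner's Sketch.lean `mirrorAssembly_holds`, axioms propext/Classical.choice/Quot.sound, attached
as evidence; same argument as `quantumAdvantage_of_crux` in
Cruxes/AvgFaceBeyondPrior/Lines/mirror_unit_signature.lean): UnitCubeCriterion → MirrorRankRare →
UnitCubeMemBQP → MirrorHeurTransfer → AvgFaceBeyondPrior → QuantumAdvantage. Proof: by
contradiction; if the summit failed, L_ε ∈ BQP (UnitCubeMemBQP) would give L_ε ∈ BPP; by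
UnitCubeCriterion the disagreement set {d : ¬(3 ∣ h(−d) ↔ d ∈ L_ε)} inside a block is contained in
{d : #Cl(ℚ(√3d))[3] ≠ 1} (d = 3 handled by h(−3) = 1), so MirrorRankRare gives the (1/6 +
ε)-agreement and MirrorHeurTransfer gives ¬AvgFaceBeyondPrior — contradiction. WHAT IT IS FOR: once
UnitCubeMemBQP and this item are CLOSED, the tenure planner installs `closes (h₁ :
UnitCubeCriterion) (h₂ : MirrorRankRare) (h₃ : AvgFaceBeyondPrior) : QuantumAdvantage :=
MirrorAssembly_proof h₁ h₂ UnitCubeMemBQP_proof MirrorHeurTransfer_proof h₃` (one `route edit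
--closes-file`; binders of `closes` must be cruxes or proved lemmas, so it cannot be installed
earlier without draft -/
@[route_item "route-QuantumAdvantage-ArithStatLadder"]
def MirrorAssembly : Prop :=
  UnitCubeCriterion → MirrorRankRare → UnitCubeMemBQP → MirrorHeurTransfer → AvgFaceBeyondPrior → QuantumAdvantage

/-- item stmt-QuantumAdvantage-15008 · support · rank 9 · open · by planner
sources: BhargavaShankarTsimerman2012, arXiv:1005.0672, TaniguchiThorne2013, arXiv:1112.5030, BhargavaTaniguchiThorne2023, Green2012
[support] SPECIAL CASE of the thesis (one restricted adversary: a single binary digit of d),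
re-filed at rev 4 with the verbatim signature of stmt-QuantumAdvantage-2423 (the tier list's
deciding crux; dropped as a CRUX at rev 3 because a ladder rung is implied by the correlation apex
behind X and implies nothing upward, so it can be no binder of `closes`; re-filed as a claimable
SUPPORT so that its matured attack and its Cruxes/DigitRung directory have an item again — supports
do not drive staffing). Statement: with t(D) = #Cl(K)[3] for the quadratic field K of discriminant D
(hypothesis on t; satisfiable by choice, iso-invariant — route reviews ×3) and 𝒟_n = {n-bit d : −d
fundamental}: ∀ ε > 0, for all large n, every position j < n and bit b, |Σ_{d ∈ 𝒟_n, bit_j(d) = b}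
(t(−d) − 2)| ≤ ε·#𝒟_n — the Davenport–Heilbronn mean 2 persists on each digit half. IN PRINT at both
ends: j ≤ (5/43 − δ)n (residue classes mod 2^{j+1}: Taniguchi–Thorne AP theorem arXiv:1112.5030 Thm
1.5; BST arXiv:1005.0672 Thm 20) and j ≥ (2/3 + δ)n (2^{n−1−j} intervals of length 2^j: BST Thm 2,
Bhargava–Taniguchi–Thorne 2023 — the tree's `btt_threeTorsion_sum`); UNPROVED in the middle band,
where {bit_j = b} is -/
@[route_item "route-QuantumAdvantage-ArithStatLadder"]
def DigitRung : Prop :=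
  ∀ t : ℤ → ℕ, (∀ (D : ℤ) (K : Type) [Field K] [NumberField K], Module.finrank ℚ K = 2 → NumberField.discr K = D → t D = Nat.card {c : ClassGroup (NumberField.RingOfIntegers K) // c ^ 3 = 1}) → ∀ ε : ℝ, 0 < ε → ∀ᶠ n : ℕ in Filter.atTop, ∀ j < n, ∀ b : Bool, |∑ d ∈ ((Finset.Ico (2 ^ (n - 1)) (2 ^ n)).filter (fun d : ℕ => (((-(d:ℤ)) % 4 = 1 ∧ Squarefree (-(d:ℤ)) ∧ (-(d:ℤ)) ≠ 1) ∨ (4 ∣ (-(d:ℤ)) ∧ ((-(d:ℤ)) / 4 % 4 = 2 ∨ (-(d:ℤ)) / 4 % 4 = 3) ∧ Squarefree ((-(d:ℤ)) / 4))))).filter (fun d : ℕ => Nat.testBit d j = b), ((t (-(d:ℤ)) : ℝ) - 2)| ≤ ε * (((Finset.Ico (2 ^ (n - 1)) (2 ^ n)).filter (fun d : ℕ => (((-(d:ℤ)) % 4 = 1 ∧ Squarefree (-(d:ℤ)) ∧ (-(d:ℤ)) ≠ 1) ∨ (4 ∣ (-(d:ℤ)) ∧ ((-(d:ℤ)) /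 4 % 4 = 2 ∨ (-(d:ℤ)) / 4 % 4 = 3) ∧ Squarefree ((-(d:ℤ)) / 4))))).card : ℝ)

/-- item stmt-QuantumAdvantage-2428 · assembly · rank 1 · closed · proved by Summit.QuantumAdvantage.QuantumAdvantage.Theorems.ArithStatLadder.Assembly_proof @ a2447a268549 (prover) · by planner
sources: Adleman1978, AroraBarakCC2009
[assembly] IqThreeMemBQP → IqThreeNotPPoly → QuantumAdvantage: if no BQP language left BPP then IQ3
∈ BQP ⊆ BPP ⊆ P/poly (Adleman1978, PROVED in the tree:
`Literature.Computability.Complexity.BPP_subset_PPoly_holds`), contradicting X. Provable NOW; proof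
term checked in the planner's Sketch.lean (theorem assembly_holds): `fun hBQP hNot => by_contra h;
exact hNot (BPP_subset_PPoly_holds (by_contra fun hBPP => h ⟨_, hBQP, hBPP⟩))`. Same shape as
Theorems/CircuitLBAssembly.lean and MobiusLadder.Assembly. -/
@[route_item "route-QuantumAdvantage-ArithStatLadder"]
def Assembly : Prop :=
  IqThreeMemBQP → IqThreeNotPPoly → QuantumAdvantage

/-! D-0027 §2.1 — DECIDING THEOREM (planner-authored via `route open/edit --closes-file`; by planner-rrepair-QuantumAdvantage-ArithStatLadd-f7a59c35-0 2026-08-16T06:37:07Z):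
its hypotheses are this route's items and its conclusion the sub-problem Statement (glue_lint), and it elaborates with this file. -/

@[closes "route-QuantumAdvantage-ArithStatLadder"] theorem closes (h₁ : IqThreeMemBQP) (h₂ : IqThreeNotBPP) : QuantumAdvantage :=
  ⟨_, h₁, h₂⟩

end Summit.QuantumAdvantage.QuantumAdvantage.Theses.ArithStatLadder
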